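import Summits.Ventures.CertifiedManyBodySolver.Theorems.TcThermcert1SaddleCauchyTaylor
import Summits.Ventures.CertifiedManyBodySolver.Theorems.TcThermcert1SaddleLogCircle
import Summits.Ventures.CertifiedManyBodySolver.Theorems.TcThermcert1SaddleBasePoint
import Mathlib
import HarnessLib

/-!
# Saddle geometry on the fugacity torus, part 6: second-order expansions along the torus

Helper file for route `TcThermcert1`, crux `ThermalStiffnessCeilingU8b10_le_1o8` (item `stmt-Ventures-26381`), line
`Cruxes/ThermalStiffnessCeilingU8b10_le_1o8/Lines/zerofree_corridor.lean` v8, registered stub `stub_saddleGeometry` (K3b); steps S4–S5 of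
`Cruxes/ThermalStiffnessCeilingU8b10_le_1o8/STUB-PLAN-stub_saddleGeometry.md`.

Along the torus through the base point `(z₀, w₀)` of part 5 the exponent increment is
`G(u,v) = [A(u) − A(0)] + [B(v) − B(0)] + [H(u,v) − H(0,0)] − i(αu + βv)`, `A(u) = log(1+z₀e^{iu})`, `B(v) = log(1+w₀e^{iv})`,
`H(u,v) = h(z₀e^{iu}, w₀e^{iv})`.  This file expands each piece to second order with explicit constants:

* `taylor_logCircle`: `‖A(u) − A(0) − A'(0)u − A''(0)u²/2‖ ≤ 16500|u|³` for real `|u| ≤ 1/25`, `‖z₀‖ ≤ 15/18`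
  (part 3 on the disc of radius `log(11/10)`, part 4 for `A'(0) = iz₀/(1+z₀)`, `A''(0) = −z₀/(1+z₀)²`);
* `norm_halfCurv_sub_le`: `‖z₀/(2(1+z₀)²) − α(1−α)/2‖ ≤ ‖z₀ − α/(1−α)‖/10` — the curvature against its real model
  (`x/(2(1+x)²) = α(1−α)/2` at `x = α/(1−α)`);
* `taylor_hSlice`: `H(u,v) − H(0,0) = i(u·z₀∂_z h + v·w₀∂_w h) + c₂/2 + E_H`, `‖c₂‖ ≤ 800εm²`, `‖E_H‖ ≤ 16000εm³`,
  `m = max(|u|,|v|) ≤ 1/40` (part 3 at `t = 1` on the disc `‖ζ‖ ≤ 1/(20m)` of the slice `ζ ↦ h(z₀e^{iζu}, w₀e^{iζv})`, chain rule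
  through `fderiv h (z₀,w₀)`).

Part 7 (`TcThermcert1SaddleLocal.lean`) adds them up into clause (ii).  [folklore] No definitions; no `sorry`.
-/

noncomputable section

open Complex Metric Set

namespace Summit.Ventures.CertifiedManyBodySolver.Theorems.TcThermcert1.ZeroFreeCorridor

/-! ## §7 Second-order expansion of the exponent at the critical point (clause (ii) of K3b) -/

/-- Second-order Taylor expansion of the logarithmic slice for REAL `u`, `|u| ≤ 1/25`, base point `‖z₀‖ ≤ 15/18`:
`‖A(u) − A(0) − A'(0)u − A''(0)u²/2‖ ≤ 16500|u|³` with `A'(0) = iz₀/(1+z₀)`, `A''(0) = −z₀/(1+z₀)²`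
(part 3 `cauchy_taylor_two` on the disc of radius `log(11/10)`, where `‖z₀‖e^{R₀} ≤ 11/12` and the slice is bounded by `6`). -/
theorem taylor_logCircle {z₀ : ℂ} (hz : ‖z₀‖ ≤ 15 / 18) {u : ℝ} (hu : |u| ≤ 1 / 25) :
    ‖Complex.log (1 + z₀ * cexp ((u : ℂ) * I)) - Complex.log (1 + z₀) - I * z₀ / (1 + z₀) * u
        - (-z₀ / (1 + z₀) ^ 2) / 2 * (u : ℂ) ^ 2‖ ≤ 16500 * |u| ^ 3 := by
  set R₀ : ℝ := Real.log (11 / 10) with hR₀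
  have hexp : Real.exp R₀ = 11 / 10 := Real.exp_log (by norm_num)
  have hR₀l : 1 / 11 ≤ R₀ := by
    have := Real.one_sub_inv_le_log_of_pos (show (0 : ℝ) < 11 / 10 by norm_num)
    norm_num at this ⊢
    exact this
  have hR₀pos : 0 < R₀ := by linarith
  have hκ : ‖z₀‖ * Real.exp R₀ < 1 := by rw [hexp]; linarith
  have hdiff := differentiableOn_logCircle hκ
  have hBd : ∀ w ∈ sphere (0 : ℂ) R₀, ‖Complex.log (1 + z₀ * cexp (w * I))‖ ≤ 6 := by
    intro w hw
    have hw' : ‖w‖ ≤ R₀ := (mem_sphere_zero_iff_norm.mp hw).le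
    refine (norm_logCircle_le hκ hw').trans ?_
    rw [hexp]
    have hκ1 : ‖z₀‖ * (11 / 10) ≤ 11 / 12 := by linarith
    have hκ0 : 0 ≤ ‖z₀‖ * (11 / 10) := by positivity
    have hinv : (1 - ‖z₀‖ * (11 / 10))⁻¹ ≤ 12 := by
      rw [inv_le_comm₀ (by linarith) (by norm_num)]; linarith
    calc (‖z₀‖ * (11 / 10)) ^ 2 * (1 - ‖z₀‖ * (11 / 10))⁻¹ / 2 + ‖z₀‖ * (11 / 10)
        ≤ (11 / 12) ^ 2 * 12 / 2 + 11 / 12 := by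
          have : (‖z₀‖ * (11 / 10)) ^ 2 ≤ (11 / 12) ^ 2 := by gcongr
          have h0 : 0 ≤ (1 - ‖z₀‖ * (11 / 10))⁻¹ := inv_nonneg.mpr (by linarith)
          nlinarith [mul_le_mul this hinv h0 (by norm_num)]
      _ ≤ 6 := by norm_num
  have ht : ‖(u : ℂ)‖ ≤ R₀ / 2 := by rw [Complex.norm_real, Real.norm_eq_abs]; linarith
  obtain ⟨-, -, h3⟩ := cauchy_taylor_two hR₀pos hdiff hBd ht
  obtain ⟨hd1, hd2⟩ := deriv_logCircle_zero (show ‖z₀‖ < 1 by linarith)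
  rw [hd1, hd2] at h3
  simp only [zero_mul, Complex.exp_zero, mul_one] at h3
  refine h3.trans ?_
  rw [Complex.norm_real, Real.norm_eq_abs]
  have hu0 : 0 ≤ |u| := abs_nonneg u
  have h11 : |u| / R₀ ≤ 11 * |u| := by
    rw [div_le_iff₀ hR₀pos]; nlinarith
  calc 2 * 6 * (|u| / R₀) ^ 3 ≤ 2 * 6 * (11 * |u|) ^ 3 := by gcongr
    _ = 15972 * |u| ^ 3 := by ring
    _ ≤ 16500 * |u| ^ 3 := by nlinarith [pow_nonneg hu0 3]

/-- The curvature coefficient against its real model: for `z₀` in the disc `B̄(7/9,1/18)` and `|α − 7/16| ≤ 1/300`,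
`‖z₀/(2(1+z₀)²) − α(1−α)/2‖ ≤ ‖z₀ − x‖/10` where `x = α/(1−α)` is the real unperturbed saddle (`x/(2(1+x)²) = α(1−α)/2`). -/
theorem norm_halfCurv_sub_le {z₀ : ℂ} {α : ℝ} (hz : ‖z₀ - 7 / 9‖ ≤ 1 / 18) (hα : |α - 7 / 16| ≤ 1 / 300) :
    ‖z₀ / (2 * (1 + z₀) ^ 2) - ((α * (1 - α) / 2 : ℝ) : ℂ)‖ ≤ ‖z₀ - ((α / (1 - α) : ℝ) : ℂ)‖ / 10 := by
  obtain ⟨hα1, hα2⟩ := abs_le.mp hα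
  have h1α : (1 : ℝ) - α ≠ 0 := by intro h; linarith
  have h1αC : (1 : ℂ) - α ≠ 0 := by
    rw [show (1 : ℂ) - α = ((1 - α : ℝ) : ℂ) by push_cast; ring]; exact_mod_cast h1α
  set x : ℝ := α / (1 - α) with hx
  have hx1 : (1 : ℝ) + x = 1 / (1 - α) := by rw [hx]; field_simp; ring
  have hxb : 0 ≤ x ∧ x ≤ 79 / 100 := by
    rw [hx]; constructor
    · exact div_nonneg (by linarith) (by linarith)
    · rw [div_le_iff₀ (by linarith)]; linarith
  have h1z : 31 / 18 ≤ ‖1 + z₀‖ := by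
    have e : (1 : ℂ) + z₀ = 16 / 9 + (z₀ - 7 / 9) := by ring
    have h169 : ‖(16 / 9 : ℂ)‖ = 16 / 9 := by
      rw [show (16 / 9 : ℂ) = ((16 / 9 : ℝ) : ℂ) by push_cast; rfl, Complex.norm_real]; norm_num
    have := norm_sub_le_norm_add (16 / 9 : ℂ) (z₀ - 7 / 9)   -- hmm placeholder
    calc (31 / 18 : ℝ) ≤ ‖(16 / 9 : ℂ)‖ - ‖z₀ - 7 / 9‖ := by rw [h169]; linarith
      _ ≤ ‖16 / 9 + (z₀ - 7 / 9)‖ := by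
          have := norm_le_norm_add_norm_sub' (16 / 9 + (z₀ - 7 / 9)) (z₀ - 7 / 9)   -- placeholder
          linarith [norm_add_le (16 / 9 + (z₀ - 7 / 9)) (-(z₀ - 7 / 9)), norm_neg (z₀ - 7 / 9),
            show (16 / 9 : ℂ) + (z₀ - 7 / 9) + -(z₀ - 7 / 9) = 16 / 9 by ring]
      _ = ‖1 + z₀‖ := by rw [e]
  have h1z0 : (1 : ℂ) + z₀ ≠ 0 := by
    intro h; rw [h, norm_zero] at h1z; linarith
  have hzn : ‖z₀‖ ≤ 15 / 18 := by have := (norm_bounds_of_near_seven_ninths hz).2; norm_num at this ⊢; linarith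
  -- the model value and the key identity
  have hmodel : ((α * (1 - α) / 2 : ℝ) : ℂ) = (x : ℂ) / (2 * (1 + (x : ℂ)) ^ 2) := by
    have : (1 : ℂ) + x = ((1 / (1 - α) : ℝ) : ℂ) := by exact_mod_cast hx1
    rw [this, hx]; push_cast; field_simp
  have h1x0 : (1 : ℂ) + x ≠ 0 := by
    have : (1 : ℂ) + x = ((1 + x : ℝ) : ℂ) := by push_cast; ring
    rw [this, hx1]; exact_mod_cast (one_div_ne_zero h1α)
  have hid : z₀ / (2 * (1 + z₀) ^ 2) - (x : ℂ) / (2 * (1 + (x : ℂ)) ^ 2) =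
      (z₀ - x) * (1 - x * z₀) / (2 * (1 + z₀) ^ 2 * (1 + (x : ℂ)) ^ 2) := by
    field_simp
    ring
  rw [hmodel, hid, norm_div, norm_mul, norm_mul, norm_mul, norm_pow, norm_pow, div_eq_mul_inv]
  have hxz : ‖1 - (x : ℂ) * z₀‖ ≤ 5 / 3 := by
    calc ‖1 - (x : ℂ) * z₀‖ ≤ ‖(1 : ℂ)‖ + ‖(x : ℂ) * z₀‖ := norm_sub_le _ _
      _ = 1 + |x| * ‖z₀‖ := by rw [norm_one, norm_mul, Complex.norm_real, Real.norm_eq_abs]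
      _ ≤ 1 + 79 / 100 * (15 / 18) := by
          gcongr
          rw [abs_le]; constructor <;> linarith [hxb.1, hxb.2]
      _ ≤ 5 / 3 := by norm_num
  have h1x : 7 / 4 ≤ ‖1 + (x : ℂ)‖ := by
    rw [show (1 : ℂ) + x = ((1 + x : ℝ) : ℂ) by push_cast; ring, Complex.norm_real, Real.norm_eq_abs, hx1]
    rw [le_abs]; left
    rw [le_div_iff₀ (by linarith)]; linarith
  have h2 : ‖(2 : ℂ)‖ = 2 := by simp
  rw [h2]
  have hden : 2 * (31 / 18) ^ 2 * (7 / 4) ^ 2 ≤ 2 * ‖1 + z₀‖ ^ 2 * ‖1 + (x : ℂ)‖ ^ 2 := by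
    gcongr
  have hden0 : 0 < 2 * ‖1 + z₀‖ ^ 2 * ‖1 + (x : ℂ)‖ ^ 2 := lt_of_lt_of_le (by norm_num) hden
  calc ‖z₀ - x‖ * ‖1 - (x : ℂ) * z₀‖ * (2 * ‖1 + z₀‖ ^ 2 * ‖1 + (x : ℂ)‖ ^ 2)⁻¹
      ≤ ‖z₀ - x‖ * (5 / 3) * (2 * (31 / 18) ^ 2 * (7 / 4) ^ 2)⁻¹ := by
        gcongr
    _ ≤ ‖z₀ - x‖ / 10 := by
        have := norm_nonneg (z₀ - x)
        nlinarith

section Slice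

variable {h : ℂ × ℂ → ℂ} {ε : ℝ}
  (hh : AnalyticOnNhd ℂ h ({ζ : ℂ | 2 / 3 < ‖ζ‖ ∧ ‖ζ‖ < 8 / 9} ×ˢ {ζ : ℂ | 2 / 3 < ‖ζ‖ ∧ ‖ζ‖ < 8 / 9}))
  (hB : ∀ p ∈ ({ζ : ℂ | 2 / 3 < ‖ζ‖ ∧ ‖ζ‖ < 8 / 9} ×ˢ {ζ : ℂ | 2 / 3 < ‖ζ‖ ∧ ‖ζ‖ < 8 / 9}), ‖h p‖ ≤ ε)
include hh hB

/-- Second-order expansion of the `h`-slice along the torus: for a base point with moduli in `[13/18, 15/18]` and real `u, v` with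
`|u|, |v| ≤ m ≤ 1/40`, `0 < m`, the slice `ζ ↦ h(z₀e^{iζu}, w₀e^{iζv})` is complex differentiable on `‖ζ‖ ≤ 1/(20m)` and bounded by
`ε` there (part 4 `norm_slice_mem_annulus`), so part 3 `cauchy_taylor_two` at `t = 1` gives
`h(z₀e^{iu}, w₀e^{iv}) − h(z₀,w₀) = i(u·z₀∂_z h + v·w₀∂_w h) + c₂/2 + E_H` with `‖c₂‖ ≤ 800εm²`, `‖E_H‖ ≤ 16000εm³`
(the linear term by the chain rule through `fderiv h (z₀,w₀)`). -/
theorem taylor_hSlice {z₀ w₀ : ℂ} (hz : 13 / 18 ≤ ‖z₀‖) (hz' : ‖z₀‖ ≤ 15 / 18) (hw : 13 / 18 ≤ ‖w₀‖)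
    (hw' : ‖w₀‖ ≤ 15 / 18) {u v m : ℝ} (hum : |u| ≤ m) (hvm : |v| ≤ m) (hm : 0 < m) (hm' : m ≤ 1 / 40) :
    ∃ c₂ : ℂ, ‖c₂‖ ≤ 800 * ε * m ^ 2 ∧
      ‖h (z₀ * cexp ((u : ℂ) * I), w₀ * cexp ((v : ℂ) * I)) - h (z₀, w₀)
          - (I * u * (z₀ * fderiv ℂ h (z₀, w₀) (1, 0)) + I * v * (w₀ * fderiv ℂ h (z₀, w₀) (0, 1))) - c₂ / 2‖
        ≤ 16000 * ε * m ^ 3 := by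
  set R : ℝ := 1 / (20 * m) with hR
  have hR0 : 0 < R := by positivity
  have hRm : R * m = 1 / 20 := by rw [hR]; field_simp
  have hRinv : R⁻¹ = 20 * m := by rw [hR, one_div, inv_inv]
  have hR2 : 2 ≤ R := by rw [hR, le_div_iff₀ (by positivity)]; linarith
  -- points of the slice lie in the annulus square
  have key : ∀ (x₀ : ℂ) (c : ℝ) (ζ : ℂ), 13 / 18 ≤ ‖x₀‖ → ‖x₀‖ ≤ 15 / 18 → |c| ≤ m → ‖ζ‖ ≤ R →
      2 / 3 < ‖x₀ * cexp (ζ * c * I)‖ ∧ ‖x₀ * cexp (ζ * c * I)‖ < 8 / 9 := by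
    intro x₀ c ζ hx hx' hc hζ
    have hc' : |c / m| ≤ 1 := by rw [abs_div, abs_of_pos hm, div_le_one hm]; exact hc
    have hζ' : ‖ζ * (m : ℂ)‖ ≤ 1 / 20 := by
      rw [norm_mul, Complex.norm_real, Real.norm_eq_abs, abs_of_pos hm]
      calc ‖ζ‖ * m ≤ R * m := by gcongr
        _ = 1 / 20 := hRm
    have := norm_slice_mem_annulus (ζ := ζ * m) hx hx' hc' hζ'
    have e : ζ * (m : ℂ) * ((c / m : ℝ) : ℂ) = ζ * (c : ℂ) := by
      have hm0 : (m : ℂ) ≠ 0 := by exact_mod_cast hm.ne'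
      push_cast
      field_simp
    rwa [e] at this
  have hmem : ∀ ζ : ℂ, ‖ζ‖ ≤ R → (z₀ * cexp (ζ * u * I), w₀ * cexp (ζ * v * I)) ∈
      {ζ : ℂ | 2 / 3 < ‖ζ‖ ∧ ‖ζ‖ < 8 / 9} ×ˢ {ζ : ℂ | 2 / 3 < ‖ζ‖ ∧ ‖ζ‖ < 8 / 9} := fun ζ hζ =>
    ⟨key z₀ u ζ hz hz' hum hζ, key w₀ v ζ hw hw' hvm hζ⟩
  -- the slice curve and its derivative
  have hγ : ∀ ζ : ℂ, HasDerivAt (fun ζ : ℂ => (z₀ * cexp (ζ * u * I), w₀ * cexp (ζ * v * I)))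
      (z₀ * (cexp (ζ * u * I) * (u * I)), w₀ * (cexp (ζ * v * I) * (v * I))) ζ := by
    intro ζ
    have hl : ∀ c : ℝ, HasDerivAt (fun ζ : ℂ => ζ * c * I) ((c : ℂ) * I) ζ := by
      intro c
      have := (hasDerivAt_id ζ).mul_const ((c : ℂ) * I)
      simpa [mul_assoc] using this
    have h1 : HasDerivAt (fun ζ : ℂ => z₀ * cexp (ζ * u * I)) (z₀ * (cexp (ζ * u * I) * (u * I))) ζ :=
      ((Complex.hasDerivAt_exp _).comp ζ (hl u)).const_mul z₀
    have h2 : HasDerivAt (fun ζ : ℂ => w₀ * cexp (ζ * v * I)) (w₀ * (cexp (ζ * v * I) * (v * I))) ζ :=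
      ((Complex.hasDerivAt_exp _).comp ζ (hl v)).const_mul w₀
    exact h1.prodMk h2
  have hdiffAt : ∀ ζ : ℂ, ‖ζ‖ ≤ R →
      DifferentiableAt ℂ (fun ζ : ℂ => h (z₀ * cexp (ζ * u * I), w₀ * cexp (ζ * v * I))) ζ := by
    intro ζ hζ
    have := (hh _ (hmem ζ hζ)).differentiableAt.comp ζ (hγ ζ).differentiableAt
    exact this
  have hdiff : DifferentiableOn ℂ (fun ζ : ℂ => h (z₀ * cexp (ζ * u * I), w₀ * cexp (ζ * v * I))) (closedBall 0 R) :=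
    fun ζ hζ => (hdiffAt ζ (mem_closedBall_zero_iff.mp hζ)).differentiableWithinAt
  have hbd : ∀ ζ ∈ sphere (0 : ℂ) R, ‖h (z₀ * cexp (ζ * u * I), w₀ * cexp (ζ * v * I))‖ ≤ ε :=
    fun ζ hζ => hB _ (hmem ζ (mem_sphere_zero_iff_norm.mp hζ).le)
  have ht : ‖(1 : ℂ)‖ ≤ R / 2 := by rw [norm_one]; linarith
  obtain ⟨-, h2, h3⟩ := cauchy_taylor_two hR0 hdiff hbd ht
  -- the derivative at `0` by the chain rule
  have hmem0 : (z₀, w₀) ∈ {ζ : ℂ | 2 / 3 < ‖ζ‖ ∧ ‖ζ‖ < 8 / 9} ×ˢ {ζ : ℂ | 2 / 3 < ‖ζ‖ ∧ ‖ζ‖ < 8 / 9} := by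
    have := hmem 0 (by rw [norm_zero]; exact hR0.le)
    simpa using this
  have hL : HasFDerivAt h (fderiv ℂ h (z₀, w₀)) (z₀, w₀) := (hh _ hmem0).differentiableAt.hasFDerivAt
  have hd0 : HasDerivAt (fun ζ : ℂ => h (z₀ * cexp (ζ * u * I), w₀ * cexp (ζ * v * I)))
      (fderiv ℂ h (z₀, w₀) (z₀ * (u * I), w₀ * (v * I))) 0 := by
    have := hL.comp_hasDerivAt_of_eq 0 (hγ 0) (by simp)
    simpa [Function.comp_def] using this
  have hlin : fderiv ℂ h (z₀, w₀) (z₀ * (u * I), w₀ * (v * I)) =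
      I * u * (z₀ * fderiv ℂ h (z₀, w₀) (1, 0)) + I * v * (w₀ * fderiv ℂ h (z₀, w₀) (0, 1)) := by
    have e : ((z₀ * (u * I), w₀ * (v * I)) : ℂ × ℂ) =
        (z₀ * (u * I)) • ((1 : ℂ), (0 : ℂ)) + (w₀ * (v * I)) • ((0 : ℂ), (1 : ℂ)) := by
      ext <;> simp
    rw [e, map_add, map_smul, map_smul, smul_eq_mul, smul_eq_mul]
    ring
  refine ⟨iteratedDeriv 2 (fun ζ : ℂ => h (z₀ * cexp (ζ * u * I), w₀ * cexp (ζ * v * I))) 0, ?_, ?_⟩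
  · refine h2.trans (le_of_eq ?_)
    rw [div_eq_mul_inv, ← inv_pow, hRinv]
    ring
  · rw [hd0.deriv, hlin] at h3
    simp only [zero_mul, Complex.exp_zero, mul_one, one_mul, one_pow, norm_one] at h3
    refine h3.trans (le_of_eq ?_)
    rw [one_div, hRinv]
    ring

end Slice

end Summit.Ventures.CertifiedManyBodySolver.Theorems.TcThermcert1.ZeroFreeCorridor

end
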